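import Literature.AlgebraicGeometry.HodgeTheory.AppellHumbertFormOfPhiPic         -- ★ (J) p731142: `linEquiv_pullback_translation_of_phiPic_eq_pow`, `cechClass_neg_eq_inv` (via PhiThetaFibres)
import Literature.AlgebraicGeometry.Motives.AbelianVarietyAmpleRiemannForm         -- ★ `isRiemannForm_of_isAmple` (+ ★ `AbelianVarietyPicZeroOfAmple`: `linEquiv_of_picClass_eq`)
import Literature.AlgebraicGeometry.Motives.AbelianVarietyDegree                   -- ★ `CartierDivisor.IsAmple.smul`
import Literature.Geometry.Kaehler.ComplexTorusDualAbelianVariety                  -- ★ `phiHEquiv` (φ_H : V ≃ Ω̄ for a non-degenerate (1,1)-form)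
import Literature.AlgebraicGeometry.HodgeTheory.AbelianVarietyHodgeFullnessHolds     -- ★ `complexAbelianVariety_torusUniformised_holds` (every complex abelian variety is torus-uniformised)
import HarnessLib

/-!
# The fibre class of `L^Δ(λ)` is an ample translate of `2Θ`

Topic `AlgebraicGeometry/HodgeTheory`; namespaces `Literature.Geometry.Kaehler.ComplexTorus` (§1) and
`Literature.AlgebraicGeometry.HodgeTheory` (§2).  KERNEL ONLY: theorems; no definition, no named fact, no instance, no `sorry`.
Cell `hodgecm-mathlib`, (U)-lane node U-e P4, N3-core socket (R), leaf (A2-tr) (P4 lead B-p03 (g14) 2026-08-29T16:10Z).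

* §1 **`AHData.exists_phiL_toPic_eq_of_mem_picZero`** ([Lange2023AbelianVarietiesComplex] §1.4.2 Lemma 1.4.5 + §1.4.1
  Prop. 1.4.1 + [Lang1982AbelianFunctions] VII §5 «`φ_E : V → V^*` is an isomorphism»): for Appell–Humbert data `(H, χ)` with
  `H` a RIEMANN form (positive definite, in particular non-degenerate), `φ_{L(H,χ)} : X → Pic⁰(X)` is ONTO — `Pic⁰(X) = X̂`
  (★ `exists_dualToPic_eq_of_mem_picZero`), `X̂ = Ω̄/Λ̂` (★ `cover`), `φ_H : V ≃ Ω̄` (★ `phiHEquiv`), `φ_L(ū) = [φ_H(u)]`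
  (★ `AHData.phiL_toPic_cover`).
* §2 **`AbelianVariety.exists_eq_cechClass_pullback_translation_two_smul_of_phiPic_eq_sq`** ([MumfordAV1970] §8 Thm. 1:
  `φ_L : A → Pic⁰(A)` is surjective for `L` ample; §6 Appl. 1): on a complex abelian variety `A` (UNCONDITIONAL — a
  uniformisation `φ : V/Λ → A(ℂ)` is taken from ★ `complexAbelianVariety_torusUniformised_holds`), if `Θ` is ample and a class `c ∈ Ȟ¹(A, 𝒪_A^×)` has `φ_c(x) = φ_Θ(x)²` for all `x ∈ A(ℂ)`, then
  `c = [t_t^*(2Θ)]` for some `t ∈ A(ℂ)`, and `t_t^*(2Θ)` is ample.  Road: `c = [D′]` (★ `CechPic.exists_cechClass_eq`);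
  `D′ − 2Θ` is translation invariant (★ (J) `linEquiv_pullback_translation_of_phiPic_eq_pow`), so `[𝒪(D′ − 2Θ)^an] ∈ Pic⁰`
  (★ `picClass_cartierDivisorLineBundle_mem_picZero`); `𝒪(2Θ)^an = L(H, χ)` with `H` a Riemann form (★
  `isRiemannForm_of_isAmple`, ★ `IsAmple.smul`), so §1 gives `t̄` with `φ_{L}(t̄) = [𝒪(D′ − 2Θ)^an]`, i.e.
  `[𝒪(t_{φ t̄}^*(2Θ) − 2Θ)^an] = [𝒪(D′ − 2Θ)^an]` (★ `picClass_cartierDivisorLineBundle_weilDiv`); GAGA injectivity on `Pic`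
  (★ `linEquiv_of_picClass_eq`) and ★ `cechClass_eq_iff_linEquiv` conclude; ampleness by ★ `IsAmple.pullback`.

## References
* [MumfordAV1970] D. Mumford, *Abelian Varieties*, §8 Thm. 1 (p. 77: `Λ(L) : X → X̂` surjective for `L` ample), §6 Appl. 1 (p. 60).
* [Lange2023AbelianVarietiesComplex] H. Lange, *Abelian Varieties over the Complex Numbers*, §1.4.1 Prop. 1.4.1 (p. 36), §1.4.2
  Lemma 1.4.5 (p. 38).
* [Lang1982AbelianFunctions] S. Lang, *Introduction to Algebraic and Abelian Functions*, 2nd ed., Ch. VII §5 (p. 119).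
-/

set_option autoImplicit false

noncomputable section

open Set Function CategoryTheory AlgebraicGeometry
open Literature.AlgebraicGeometry.Motives Literature.AlgebraicGeometry.Motives.RatFn
open Literature.Geometry.Kaehler Literature.Geometry.Kaehler.ComplexTorus
open Literature.NumberTheory.Transcendental
open Literature.AlgebraicGeometry.AbelianVarieties Literature.AlgebraicGeometry.Modules

/-! ### §1. `φ_L : X → Pic⁰(X)` is onto for `L = L(H, χ)` with `H` a Riemann form -/

namespace Literature.Geometry.Kaehler.ComplexTorus

section Torus

variable {ι : Type*} {E : Type*} [NormedAddCommGroup E] [NormedSpace ℂ E] {Φ : (ι → ℝ) ≃L[ℝ] E}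
  [Fintype ι] [DecidableEq ι] [FiniteDimensional ℂ E]

/-- **`φ_{L(H,χ)} : X → Pic⁰(X)` is surjective when `H` is a Riemann form** (hence non-degenerate of type `(1,1)`):
every class with `c₁ = 0` is `φ_L(t̄)` for some `t̄ ∈ X` — `Pic⁰(X) = X̂ = Ω̄/Λ̂`, `φ_H : V ⥲ Ω̄`, `φ_L(ū) = [φ_H(u)]` (Lemma 1.4.5).
[cite: Lange2023AbelianVarietiesComplex, §1.4.2 Lemma 1.4.5 (p. 38) and §1.4.1 Prop. 1.4.1 (p. 36)]
[cite: Lang1982AbelianFunctions, Ch. VII §5 (p. 119)] -/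
theorem AHData.exists_phiL_toPic_eq_of_mem_picZero (p : AHData Φ) (hR : IsRiemannForm Φ p.form) {z : Pic Φ}
    (hz : z ∈ picZero Φ) : ∃ t : ComplexTorus Φ, Pic.phiL (AHData.toPic p) t = z := by
  obtain ⟨s, rfl⟩ := exists_dualToPic_eq_of_mem_picZero Φ hz
  obtain ⟨ξ, rfl⟩ : ∃ ξ, cover (dualPeriod Φ) ξ = s := ⟨_, cover_apply_lift s⟩
  obtain ⟨u, hu⟩ := (phiHEquiv Φ hR.1 hR.nondegenerate).surjective ξ
  refine ⟨cover Φ u, ?_⟩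
  rw [AHData.phiL_toPic_cover, ← hu, phiHEquiv_apply]

end Torus

end Literature.Geometry.Kaehler.ComplexTorus

/-! ### §2. A class with `φ_c = φ_Θ²` on a complex abelian variety is the class of an ample translate of `2Θ` -/

namespace Literature.AlgebraicGeometry.HodgeTheory

section Translate

/-- **THE (A2-tr) LEAF — a class with `φ_c = φ_Θ²` is the class of an ample translate of `2Θ`** (unconditional: the
uniformisation is ★ `complexAbelianVariety_torusUniformised_holds`).  On a complex abelian variety `A`, let `Θ` be ample and
`c ∈ Ȟ¹(A, 𝒪_A^×)` satisfy `φ_c(x) = φ_Θ(x)²` for every `x ∈ A(ℂ)` (e.g. the fibre class of `L^Δ(λ_Θ)`, ★ T1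
`phiPic_detClass_restrict_LDelta`).  Then `c = [𝒪(t_t^*(2Θ))]` for some `t ∈ A(ℂ)`, and `t_t^*(2Θ)` is ample (Mumford §8
Thm. 1: `φ_{2Θ}` maps `A` ONTO `Pic⁰(A)`; read on a uniformising torus through §1 and brought back by GAGA injectivity on `Pic`,
★ `linEquiv_of_picClass_eq`).
[cite: MumfordAV1970, §8 Thm. 1 (p. 77) and §6 Appl. 1 (p. 60)] [cite: Lange2023AbelianVarietiesComplex, §1.4.2 Lemma 1.4.5 (p. 38)] -/
theorem AbelianVariety.exists_eq_cechClass_pullback_translation_two_smul_of_phiPic_eq_sq (A : AbelianVariety ℂ)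
    {Θ : CartierDivisor A.X.left} (hΘ : Θ.IsAmple) (c : CechPic A.X.left)
    (h : ∀ x : A.Points ℂ, phiPic A c x = phiPic A Θ.cechClass x ^ 2) :
    ∃ t : A.Points ℂ, c = ((2 • Θ).pullback (A.translation t).left).cechClass ∧
      ((2 • Θ).pullback (A.translation t).left).IsAmple := by
  -- a uniformisation `φ : V/Λ → A(ℂ)` compatible with the group laws
  obtain ⟨ι, _, _, Φ, φ, hφ, hadd⟩ := complexAbelianVariety_torusUniformised_holds A
  -- `c` is a divisor class `[D′]`, and `2Θ` is ample
  obtain ⟨D', hD'⟩ := CechPic.exists_cechClass_eq c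
  have h2 : (2 • Θ).IsAmple := hΘ.smul two_pos
  -- Appell–Humbert data of `𝒪(2Θ)^an`; its form is a Riemann form
  obtain ⟨p, hp⟩ := AHData.toPic_surjective (picClass (cartierDivisorLineBundle hφ (2 • Θ)))
  have hR : IsRiemannForm Φ p.form := Motives.AbelianVariety.isRiemannForm_of_isAmple A hφ hadd h2 p hp
  -- `[𝒪(D′ − 2Θ)^an] ∈ Pic⁰(X)`
  have hx : ∀ x : A.Points ℂ, phiPic A D'.cechClass x = phiPic A Θ.cechClass x ^ 2 := by
    rw [hD']
    exact h
  have hmem := picClass_cartierDivisorLineBundle_mem_picZero A hφ hadd (D' + -(2 • Θ))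
    (Motives.AbelianVariety.linEquiv_pullback_translation_of_phiPic_eq_pow A Θ D' 2 hx)
  -- `φ_{𝒪(2Θ)^an}` is onto `Pic⁰`: pick `t̄` with `φ(t̄) = [𝒪(D′ − 2Θ)^an]`
  obtain ⟨tt, htt⟩ := ComplexTorus.AHData.exists_phiL_toPic_eq_of_mem_picZero p hR hmem
  refine ⟨φ tt, ?_, h2.pullback _⟩
  -- `[𝒪(t_{φ t̄}^*(2Θ) − 2Θ)^an] = φ(t̄) = [𝒪(D′ − 2Θ)^an]` ⇒ linear equivalence by GAGA injectivity ⇒ equal classes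
  have hweil : picClass (cartierDivisorLineBundle hφ (A.weilDiv (2 • Θ) (φ tt))) =
      picClass (cartierDivisorLineBundle hφ (D' + -(2 • Θ))) := by
    rw [picClass_cartierDivisorLineBundle_weilDiv A hφ hadd (2 • Θ) tt, ← hp, htt]
  have hcc := (CartierDivisor.cechClass_eq_iff_linEquiv _ _).2
    (Motives.AbelianVariety.linEquiv_of_picClass_eq A hφ hweil)
  rw [Motives.AbelianVariety.weilDiv, CartierDivisor.cechClass_add, CartierDivisor.cechClass_add,
    Motives.AbelianVariety.cechClass_neg_eq_inv A, hD'] at hcc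
  exact (mul_right_cancel hcc).symm

end Translate

end Literature.AlgebraicGeometry.HodgeTheory

end
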